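import Summits.FinalStateConjecture.FinalStateConjecture.Theses.EIHFluxBalance

/-!
# S5 `stub_cesaroRecharting` — worker analysis (2026-08-16): STUB-MISSTATED

Verdict: the registered signature is true in the intended models but NOT provable as typed; it becomes
provable (size XL, the ideator-2 plan) after adding two antecedent clauses, (O) orthochronous paintings
and (R1) causal convexity in `M` of the charted late exterior `Φ '' E(τ₀)`
(`E(t) = {x : U | t < x⁰ ∧ ∀ i, r₊ < rᵢ(x)}`, the set of clauses (iii)/(vi)). The corrected statement,
elaborated rc 0 (one `sorry`), is `stub_cesaroRecharting_corrected.lean` next to this file. Push-up is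
NOT the blocker: it is proved in the tree (`LorentzianMetric.chronologicalFuture_causalFuture_holds_of_boundaryless`,
`Literature.Geometry.Lorentzian.CausalityPushUp`), contrary to the brief.

## 1. What the definitions demand (Statement.lean, KerrConvergence.lean)

* `HasExhaustiveCharts d` (ii): `∀ τ₁ > d.τ₀, O' \ certifiedLate d R τ₁ ⊆ J⁻(certifiedSlab d R τ₁)` —
  the CAUSAL PAST OF THE SLAB, not of the late region.
* hole background `boostedKerrBackground Λᵢ cᵢ`: time `t*ᵢ(y) = (Λᵢ⁻¹(y − cᵢ))⁰` (rest-frame KS time),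
  convergence target `boostedKerrBilin Λᵢ cᵢ Mᵢ aᵢ` on `{t*ᵢ = τ, rᵢ ≤ R}` in `C²`;
  `setOf_lt_excision_subset_flatDomain` ties `(Λᵢ, cᵢ)` to straight tubes in FLAT-chart coordinates, so
  `Λᵢ = boost(Vᵢ)` with `Vᵢ` the Cesàro velocity (`|Vᵢ| ≤ κ² < 1`).

## 2. N = 1, uniformly moving hole (`Λ ≡ boost(V)`, `ξ(t) = Vt`, `V ≠ 0`): the tilt is forced

(a) Hole chart `Ψ = Φ ∘ F` with `F^*G → g_ref` in `C²` forces `dF →` (Lorentz) pointwise: with a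
lab-slab Fermi map `F(τ, z̲) = (T(τ), ξ(T) + S(T) z̲)` one gets `F^*G = A^*g_KS` with the NON-Lorentz
frame `A e₀ = e₀`, `A e_k = e_k + (Λ⁻¹(0, S e_k))⁰ e₀ = e_k − (u·e_k) e₀` (`u ≠ 0`), whose far field
is `A^*η ≠ η` — convergence fails; any
label (`Λ_V = 1` included) gives slabs `Φ(F{t* = τ})` = rest-frame simultaneity discs, at lab times
`≈ γτ + γV·z̲`. (b) Tilting the FLAT chart near the tube instead (`Φ ∘ A`, `A ≈` boost inside,
`= id` outside): the displacement of a boost about any fixed event grows like `|V| x⁰`, so the strain of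
the interpolation is `≳ |V| x⁰ / L(x⁰)` with `L = o(x⁰)` — `A^*η − η = O(1)`, flat convergence fails
(Killing rigidity); the flat chart is pinned to the lab frame. (c) `d.N = 0` is impossible (a flat chart
`C²`-close to `η` cannot cover `r ≈ r₊`, Kretschmann `≠ 0`; uncovered near-horizon late points of `O'`
violate (ii)). Hence `certifiedSlab(τ₁) = Φ{x⁰ = τ₁, off tubes} ∪ Ψ{t* = τ₁, r ≤ R(τ₁)}`, the disc
sitting at lab times `≈ γτ₁ ± γ|V|R`.

## 3. The points that cannot be certified from the typed antecedent

`p = Φ(x)` in the tube with `t*(p) ≤ τ₁ < x⁰(p)` (lab times in `(τ₁, ≈ γτ₁)`, nonempty iff `V ≠ 0`),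
`r₊ < r(p)`: `p ∈ Ψ{t* > d.τ₀} ⊆ d.charted ⊆ O'` for EVERY admissible `d` (the hole chart is rigid up to
`o(1)` near `r₊`), `p ∉ certifiedLate(τ₁)`, and `Φ{x⁰ = τ₁}` is in `p`'s lab past; so (ii) needs a
future causal curve from `p` to the disc `Ψ{t* = τ₁, r ≤ R(τ₁)}`, i.e. survival outside the hole for
rest time up to `τ₁(1 − 1/γ) → ∞`. Explicit curves exist only off the layer `r₊ < r < r₊ + cε(t)`
(hover margin `G(K,K) ≈ −2κ_sg(r − r₊)` against the deviation `ε`); in the layer the ONLY input is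
(vii), which gives τ-future causal curves `σ` from `p` to LAB slabs `Φ{x⁰ = t₁, r > r₊}`. Turning such a
`σ` into a hit of `{t* = τ₁}` is an intermediate-value argument for the continuous painted rest time
along `σ`, valid only while `σ ⊆ Φ(E(τ₀))`; a `σ` leaving the charted exterior (into `M ∖ Φ(U)`, or
into a painted interior and back) and re-entering defeats it. Monotonicity of `J⁻` in any form
((vii) at a dilated lab time `T(τ₁) ≈ γ_max τ₁`) lands in `certifiedLate(τ₁)`, never in
`J⁻(certifiedSlab(τ₁))`.

## 4. Why causal convexity is not derivable (even with push-up, which IS proved)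

With push-up, intermediate points `y` of `σ` lie in `O`, and (vii) then yields for `y ∉ Φ(E(τ₀))`
only "downward" curves `x ≤ y ≤ w ∈ Φ{x⁰ = t₁}` with `t₁ < x⁰(x)`. A contradiction needs lab-time
monotonicity along causal curves of `M` joining chart points (equivalent, modulo push-up and the local
time-function property of §6, to causal convexity of `Φ(E(τ₀))`), or a closed causal loop — impossible
to build since the endpoint `w` has uncontrolled position on the slab. The antecedent's global clauses
(iii) `A ⊆ O`, (vi) `O = J⁺(ιX) ∩ I⁻(A)`, (vii) only become EASIER when `J⁻` is enlarged by curves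
leaving the chart; `IsCauchyHypersurface (range ι)` and maximality say nothing about how `Φ(U)` sits in
`M`. No rigorous counterexample is available either (no MGHD of one-ended admissible data with `N ≥ 1`
satisfying the antecedent is known), hence mis-stated rather than false.

## 5. Orthochronicity

`lorentzGroup = O(1,3)` and clause (ii) bounds only `|(Λᵢe₀)⁰|`. For anti-orthochronous `Λᵢ(t)`
(constant class by continuity) `boostedKerrBilin = η + H (ℓ∘Λᵢ⁻¹)²` is the OUTGOING (white-hole)
Kerr–Schild form w.r.t. increasing lab time, while every hole chart must converge to the ingoing form
`Kerr.bilin` in increasing background time with its late region inside `Φ(U_late) ∩ O'` — impossible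
(a time-reversing or time-compressing `F` destroys `C²` convergence); (vii) is consistent with a late
white-hole exterior, so the case cannot be dismissed from the antecedent. Clause (O) `0 < (Λᵢ(t)e₀)⁰`.

## 6. Why (O) + (R1) suffice (proof plan for the corrected stub; XL, not attempted here)

* `x⁰` is a `g`-time function on the late canonical region: `G = η + Σ Hᵢ (ℓᵢ∘Λᵢ⁻¹)²`, `Hᵢ ≥ 0`, so
  `G(v,v) ≥ η(v,v)` EXACTLY; with `‖dev‖ < 1`, `(G+dev)(v,v) ≤ 0, v ≠ 0 ⟹ v⁰ ≠ 0`; Darboux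
  (`Mathlib.Analysis.Calculus.Darboux`) ⟹ `x⁰ ∘ Φ⁻¹ ∘ σ` monotone for causal `σ` in the late chart
  region; the sign is `+` from ONE (vii)-curve kept inside `Φ(E(τ₀))` by (R1) (inf/sup argument: a
  late curve in `Φ(E(τ₀))` never drops below its initial lab time). Same for the painted rest times
  `t*ᵢ` where needed (not even required: `s* := inf {s | t*ᵢ(σ s) ≥ τ₁}` and continuity suffice).
* Tube point `p`, `t*ᵢ(p) ≤ τ₁`: (vii) at a huge `t₁`; `σ ⊆ Φ(E(τ₀))` by (R1); `s*` as above,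
  `s_e := inf {s | rᵢ(σ s) ≥ R♭(x⁰(σ s))}` with `ρᵢ < R♭(t) ≤ Rᵢ(t/(2γ_max))/2`; if `s* ≤ s_e` then
  `σ s* ∈ Ψᵢ(truncTimeSlab (Rᵢ τ₁) τ₁)`; else hover explicitly from `σ s_e` at fixed painted position
  (`r = R♭ ≫ M`, `G`-margin `≈ 1`, co-moving with the slaved painting, `|u| ≤ κ`) until `t*ᵢ = τ₁`,
  glue by `LorentzianMetric.causalFuture_causalFuture` (proved). Flat/early points reduce to this by
  (vii) at `t₁ = τ₁`, resp. `t₁ = d.τ₀`, with offsets `cᵢ` chosen so that `t*ᵢ ≤ x⁰` on the initial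
  lab slab's near zones.
* The rest is the ideator-2 differential geometry: hole charts `Φ ∘ (P_act(t) ∘ P_{Vᵢ}⁻¹)` on the
  mollified slaved motion with radial compression into the Voronoi tube `D(t)/3`, label `boost(Vᵢ)`,
  `Rᵢ → ∞` slowly (`|Λ̇ᵢ| Rᵢ → 0`), flat chart `Φ` off tubes `ρᵢ = 2γ̄(|ξᵢ − Vᵢt − c̲ᵢ| + Rᵢ') = o(t)`
  (Cesàro), bricks `…FlatChart/AnsatzDecay/BoostedDecay/Rechart/ChartCalculus`; slaving
  `ξ̇ᵢ − uᵢ → 0` and adiabaticity modulo the KS stabiliser from `Ric(Φ^*g) = 0` + `C³` (S3b's content).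
-/
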